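import Mathlib.NumberTheory.ArithmeticFunction.Moebius
import Mathlib.NumberTheory.ArithmeticFunction.VonMangoldt
import Mathlib.Data.Nat.Totient
import Mathlib.Analysis.Real.Sqrt
import Mathlib.Algebra.BigOperators.Field
import Mathlib.Analysis.SpecialFunctions.Log.Basic
import Mathlib.Algebra.Order.Chebyshev
import HarnessLib

/-!
# The KMV second-moment main term in Selberg coordinates: an explicit lower bound over ARBITRARY
# coefficients (Soundararajan's completion of squares, transplanted to `GL(2)`)

Topic `Literature/NumberTheory/LFunctions` (namespace `Literature.NumberTheory.LFunctions.KMV2000`,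
sub-namespace `SelbergCoord`). PROVED, elementary real algebra over explicit finite sums; NO named
facts are introduced. Typed for the LANDAU–SIEGEL PROGRAMME (cell `landau-siegel`, §B-fam row famE-09
= `KMV2000.LinearMollifierOptimality`, and the §E residue (δ) of the B-fam class statement): it is the
finite inequality «(FT)» of `B-fam/num-2/fame09/FAME09-MODEL-THEOREM.md` (lineage-B derivation,
certified numerically in kit jobs j260732/j260771), i.e. the MODEL-level hard half of famE-09.
FRAMING: the programme SEARCHES and TYPES; nothing here is a claim about `L`-functions.

## The objects (a DERIVATION about the objects of the cited sources, labelled as such)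

In KMV's harmonic prime-level `k = 0` main-term model ([KowalskiMichelVanderKam2000] (14)–(16),
(21)–(23); the cell's fam-Q08 model) the second mollified moment of a general linear mollifier
`Σ_{m ≤ M} x_m λ_f(m) m^{-1/2}` is the quadratic form `xᵀKx`,
`K_ab = (ab)⁻¹ Σ_{c | (a,b)} c·τ(ab/c²)·(L + log c − ½ log ab)`, `L = log q̂`, and the first moment is
`ℓ(x) = Σ x_m/m`. In the «Selberg coordinates» `A_n := Σ_{n | m ≤ M} τ(m/n) x_m/m` (an invertible
unitriangular change of variables) one has the EXACT identity (lineage-B Claim 1, verified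
symbolically; lineage-A `Q08-PROBE.md` §7 one step earlier)
`xᵀKx = F_{M,L}(A) := Σ_{n ≤ M} φ(n)(L + κ(n)) A_n² − 2 Σ_{n | m ≤ M, n < m} φ(n) Λ(m/n) A_n A_m`,
`ℓ(x) = Σ_{n ≤ M} μ(n) A_n`, with `κ(n) = Σ_{p | n} log p/(p − 1)` — literally the shape of
Soundararajan's form for the `ζ` mean square ([Radziwill2012] §7, Proposition B: there
`log T · Σ φ(n) y_n² − 2Σ_{n|m} φ(n)Λ(m/n) y_n y_m` up to negligible terms, constraint `Σ μ(n) y_n = 1`).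
This file takes `F_{M,L}` (`scForm`) and `Σ μ(n) A_n` (`mobForm`) AS THE OBJECTS and proves, by
Soundararajan's completion of squares ([Radziwill2012] §7 Lemmas 9–14) made fully explicit and
error-free, the finite lower bound

  `F_{M,L}(A) ≥ L/G + P/G² − B(t)/(G²(L − Λ♯))`  whenever `Σ μ(n) A_n = 1`, `Λ♯ < L`,

where `G = Σ_{n≤M} μ(n)²/φ(n)`, `P = F_{M,0}(μ/φ)`, `B(t) = Σ_m (c_m − tμ(m))²/φ(m)` with `c_m` the
explicit linear coefficients of `F_{M,0}` at the centre `μ/φ`, `t` a free real parameter, and `Λ♯`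
any bound for the explicit AM–GM coefficients `cAM(n) − κ(n)` (numerically and on paper
`cAM(n) = Σ_{k ≤ M/n} Λ(k)/k + log n + κ(n)`, so `Λ♯ = log M + O(1)` works; with `L = (log M)/Δ`,
`Δ < 1`, the right-hand side tends to `1 + 1/Δ`, i.e. `sup_x ℓ(x)²/(2xᵀKx) → Δ/(2(1+Δ)) =
KMV2000.envelope Δ` — the asymptotic evaluation is NOT done in this file).
By homogeneity the theorem bounds the Rayleigh quotient `(Σ μ(n)A_n)²/F_{M,L}(A)` for every `A`.

## References

* [Radziwill2012] M. Radziwiłł, *Limitations to mollifying ζ(s)*, arXiv:1207.6583, §7 (Proposition B,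
  due to K. Soundararajan; Lemmas 9–14) — the method.
* [KowalskiMichelVanderKam2000] §§3–5, (14)–(16), (21)–(23) — the forms being modelled.
* [CechMatomaki2025] Remark 1.2 — names [Radziwill2012] §7 as the one rigorous optimality proof in print.
-/

noncomputable section

open Finset

namespace Literature.NumberTheory.LFunctions.KMV2000.SelbergCoord

/-- `κ(n) = Σ_{p | n} log p / (p − 1)`, the arithmetic correction on the diagonal of the Selberg-
coordinates form (it is `−(n/φ(n))·Σ_{g|n} μ(g) log g / g`). A derivation about the diagonal main term
(23) of the source. [cite: KowalskiMichelVanderKam2000, §5 (21)–(23) — derivation] -/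
def kappa (n : ℕ) : ℝ := ∑ p ∈ n.primeFactors, Real.log p / ((p : ℝ) - 1)

/-- The off-diagonal weight of the Selberg-coordinates form: `w(n,m) = φ(n)Λ(m/n)` if `n | m`, `n < m`,
else `0` (von Mangoldt coupling along divisor chains). [cite: Radziwill2012, §7 Lemma 11 — derivation] -/
def wt (n m : ℕ) : ℝ :=
  if n ∣ m ∧ n < m then (Nat.totient n : ℝ) * ArithmeticFunction.vonMangoldt (m / n) else 0

/-- **The second-moment main term in Selberg coordinates**
`F_{M,L}(A) = Σ_{n≤M} φ(n)(L + κ(n))A_n² − 2Σ_{n|m≤M, n<m} φ(n)Λ(m/n)A_nA_m` (`= xᵀKx` of the KMV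
`k = 0` harmonic main-term model under `A_n = Σ_{n|m} τ(m/n)x_m/m`; the cell's Claim 1).
[cite: Radziwill2012, §7 Proposition B — derivation (GL(2) analogue)] -/
def scForm (M : ℕ) (L : ℝ) (A : ℕ → ℝ) : ℝ :=
  ∑ n ∈ Icc 1 M, (Nat.totient n : ℝ) * (L + kappa n) * A n ^ 2
    - 2 * ∑ n ∈ Icc 1 M, ∑ m ∈ Icc 1 M, wt n m * A n * A m

/-- The first-moment main term in Selberg coordinates, `Σ_{n≤M} μ(n) A_n` (`= Σ x_m/m`).
[cite: Radziwill2012, §7 (Möbius inversion `1 = Σ y(ℓ)μ(ℓ)/ℓ`) — derivation] -/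
def mobForm (M : ℕ) (A : ℕ → ℝ) : ℝ :=
  ∑ n ∈ Icc 1 M, (ArithmeticFunction.moebius n : ℝ) * A n

/-- `G = Σ_{n≤M} μ(n)²/φ(n)` (Soundararajan's `G`). [cite: Radziwill2012, §7 Lemma 9] -/
def scG (M : ℕ) : ℝ :=
  ∑ n ∈ Icc 1 M, (ArithmeticFunction.moebius n : ℝ) ^ 2 / (Nat.totient n : ℝ)

/-- The (unnormalised) completion centre `μ(n)/φ(n)`; Soundararajan's `z(ℓ)/ℓ` is this divided by `G`.
[cite: Radziwill2012, §7 Lemma 9] -/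
def zc (n : ℕ) : ℝ := (ArithmeticFunction.moebius n : ℝ) / (Nat.totient n : ℝ)

/-- The symmetric bilinear form of `F_{M,0}`:
`bil0(u,v) = Σ φ(n)κ(n)u_nv_n − Σ_{n,m} w(n,m)(u_nv_m + u_mv_n)`.
[cite: Radziwill2012, §7 (decomposition `S₁ − S₂ + S₃`) — derivation] -/
def bil0 (M : ℕ) (u v : ℕ → ℝ) : ℝ :=
  ∑ n ∈ Icc 1 M, (Nat.totient n : ℝ) * kappa n * u n * v n
    - ∑ n ∈ Icc 1 M, ∑ m ∈ Icc 1 M, wt n m * (u n * v m + u m * v n)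

/-- The explicit linear coefficients of `F_{M,0}` at `u`:
`c_m(u) = φ(m)κ(m)u_m − Σ_n w(n,m)u_n − Σ_k w(m,k)u_k`, so that `bil0(u,v) = Σ_m v_m c_m(u)`.
[cite: Radziwill2012, §7 Lemma 13 — derivation] -/
def linCoeff (M : ℕ) (u : ℕ → ℝ) (m : ℕ) : ℝ :=
  (Nat.totient m : ℝ) * kappa m * u m - ∑ n ∈ Icc 1 M, wt n m * u n - ∑ k ∈ Icc 1 M, wt m k * u k

/-- `P = F_{M,0}(μ/φ)` (on paper `= K + 2S = Σ μ²κ/φ + 2Σ_n μ²(n)/φ(n)·Σ_{p≤M/n, p∤n} log p/(p−1)`;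
Soundararajan's `−S₃` term times `G²`, plus the `κ`-diagonal). [cite: Radziwill2012, §7 Lemma 14 — derivation] -/
def scP (M : ℕ) : ℝ := scForm M 0 zc

/-- `B(t) = Σ_{m≤M} (c_m(μ/φ) − t·μ(m))²/φ(m)`, the Cauchy–Schwarz weight of the linear term
(`t` free: the `tμ` shift is invisible on the constraint surface). [cite: Radziwill2012, §7 Lemma 13 — derivation] -/
def scB (M : ℕ) (t : ℝ) : ℝ :=
  ∑ m ∈ Icc 1 M, (linCoeff M zc m - t * (ArithmeticFunction.moebius m : ℝ)) ^ 2 / (Nat.totient m : ℝ)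

/-- The explicit AM–GM coefficient `cAM(n) = (Σ_m w(n,m)·(n/m) + Σ_k w(k,n)·(n/k))/φ(n)`
(on paper `= Σ_{k≤M/n}Λ(k)/k + log n + κ(n)`). [cite: Radziwill2012, §7 Lemma 12 — derivation] -/
def cAM (M : ℕ) (n : ℕ) : ℝ :=
  (∑ m ∈ Icc 1 M, wt n m * ((n : ℝ) / (m : ℝ)) + ∑ k ∈ Icc 1 M, wt k n * ((n : ℝ) / (k : ℝ)))
    / (Nat.totient n : ℝ)

/-! ### Elementary facts about the weights -/

/-- `w(n,m) ≥ 0`. [cite: Radziwill2012, §7 — derivation] -/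
theorem wt_nonneg (n m : ℕ) : 0 ≤ wt n m := by
  unfold wt
  split_ifs
  · exact mul_nonneg (Nat.cast_nonneg _) ArithmeticFunction.vonMangoldt_nonneg
  · exact le_rfl

/-- `φ(n) > 0` as a real number for `n ∈ [1, M]`. [folklore] -/
private theorem totient_pos_of_mem {M n : ℕ} (hn : n ∈ Icc 1 M) : (0 : ℝ) < (Nat.totient n : ℝ) := by
  have h1 : 1 ≤ n := (mem_Icc.mp hn).1
  exact_mod_cast Nat.totient_pos.mpr (by omega)

/-- `μ(n)·(μ(n)/φ(n)) = μ(n)²/φ(n)`. [folklore] -/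
private theorem moebius_mul_zc (n : ℕ) :
    (ArithmeticFunction.moebius n : ℝ) * zc n = (ArithmeticFunction.moebius n : ℝ) ^ 2 / (Nat.totient n : ℝ) := by
  unfold zc; ring

/-- `φ(n)·(μ(n)/φ(n))² = μ(n)²/φ(n)` for `n ∈ [1,M]`. [folklore] -/
private theorem totient_mul_zc_sq {M n : ℕ} (hn : n ∈ Icc 1 M) :
    (Nat.totient n : ℝ) * zc n ^ 2 = (ArithmeticFunction.moebius n : ℝ) ^ 2 / (Nat.totient n : ℝ) := by
  have hφ := (totient_pos_of_mem hn).ne'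
  unfold zc
  field_simp

/-- `Σ μ(n)·zc(n) = G`. [cite: Radziwill2012, §7 Lemma 9] -/
theorem mobForm_zc (M : ℕ) : mobForm M zc = scG M := by
  unfold mobForm scG
  exact sum_congr rfl fun n _ => moebius_mul_zc n

/-- `Σ φ(n) zc(n)² = G`. [cite: Radziwill2012, §7 Lemma 9] -/
theorem sum_totient_zc_sq (M : ℕ) :
    ∑ n ∈ Icc 1 M, (Nat.totient n : ℝ) * zc n ^ 2 = scG M := by
  unfold scG
  exact sum_congr rfl fun n hn => totient_mul_zc_sq hn

/-- `G ≥ 1 > 0` for `M ≥ 1` (the term `n = 1` is `1`, the others are `≥ 0`). [cite: Radziwill2012, §7 Lemma 9] -/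
theorem one_le_scG {M : ℕ} (hM : 1 ≤ M) : 1 ≤ scG M := by
  unfold scG
  have h1 : (1 : ℕ) ∈ Icc 1 M := mem_Icc.mpr ⟨le_rfl, hM⟩
  have hterm : (ArithmeticFunction.moebius 1 : ℝ) ^ 2 / (Nat.totient 1 : ℝ) = 1 := by
    simp
  calc (1 : ℝ) = (ArithmeticFunction.moebius 1 : ℝ) ^ 2 / (Nat.totient 1 : ℝ) := hterm.symm
    _ ≤ ∑ n ∈ Icc 1 M, (ArithmeticFunction.moebius n : ℝ) ^ 2 / (Nat.totient n : ℝ) := by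
        apply single_le_sum (f := fun n => (ArithmeticFunction.moebius n : ℝ) ^ 2 / (Nat.totient n : ℝ)) _ h1
        intro n hn
        exact div_nonneg (sq_nonneg _) (totient_pos_of_mem hn).le

/-- `G > 0` for `M ≥ 1`. [cite: Radziwill2012, §7 Lemma 9] -/
theorem scG_pos {M : ℕ} (hM : 1 ≤ M) : 0 < scG M := lt_of_lt_of_le one_pos (one_le_scG hM)

/-! ### Algebra of the form -/

/-- Splitting off the `L`-part: `F_{M,L}(A) = L·Σφ A² + F_{M,0}(A)`. [cite: Radziwill2012, §7 (first display) — derivation] -/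
theorem scForm_split (M : ℕ) (L : ℝ) (A : ℕ → ℝ) :
    scForm M L A = L * ∑ n ∈ Icc 1 M, (Nat.totient n : ℝ) * A n ^ 2 + scForm M 0 A := by
  have h : ∑ n ∈ Icc 1 M, (Nat.totient n : ℝ) * (L + kappa n) * A n ^ 2
      = L * ∑ n ∈ Icc 1 M, (Nat.totient n : ℝ) * A n ^ 2
        + ∑ n ∈ Icc 1 M, (Nat.totient n : ℝ) * (0 + kappa n) * A n ^ 2 := by
    rw [mul_sum, ← sum_add_distrib]
    exact sum_congr rfl fun n _ => by ring
  unfold scForm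
  rw [h]; ring

/-- Scaling: `F_{M,L}(c·u) = c²·F_{M,L}(u)`. [cite: Radziwill2012, §7 — derivation] -/
theorem scForm_smul (M : ℕ) (L c : ℝ) (u : ℕ → ℝ) :
    scForm M L (fun n => c * u n) = c ^ 2 * scForm M L u := by
  unfold scForm
  have h1 : ∑ n ∈ Icc 1 M, (Nat.totient n : ℝ) * (L + kappa n) * (c * u n) ^ 2
      = c ^ 2 * ∑ n ∈ Icc 1 M, (Nat.totient n : ℝ) * (L + kappa n) * u n ^ 2 := by
    rw [mul_sum]; exact sum_congr rfl fun n _ => by ring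
  have h2 : ∑ n ∈ Icc 1 M, ∑ m ∈ Icc 1 M, wt n m * (c * u n) * (c * u m)
      = c ^ 2 * ∑ n ∈ Icc 1 M, ∑ m ∈ Icc 1 M, wt n m * u n * u m := by
    rw [mul_sum]
    refine sum_congr rfl fun n _ => ?_
    rw [mul_sum]
    exact sum_congr rfl fun m _ => by ring
  rw [h1, h2]; ring

/-- Scaling of the linear coefficients: `c_m(c·u) = c·c_m(u)`. [cite: Radziwill2012, §7 — derivation] -/
theorem linCoeff_smul (M : ℕ) (c : ℝ) (u : ℕ → ℝ) (m : ℕ) :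
    linCoeff M (fun n => c * u n) m = c * linCoeff M u m := by
  unfold linCoeff
  have h1 : ∑ n ∈ Icc 1 M, wt n m * (c * u n) = c * ∑ n ∈ Icc 1 M, wt n m * u n := by
    rw [mul_sum]; exact sum_congr rfl fun n _ => by ring
  have h2 : ∑ k ∈ Icc 1 M, wt m k * (c * u k) = c * ∑ k ∈ Icc 1 M, wt m k * u k := by
    rw [mul_sum]; exact sum_congr rfl fun k _ => by ring
  rw [h1, h2]; ring

/-- Scaling of `Σ φ u²`. [folklore] -/
private theorem sum_totient_sq_smul (M : ℕ) (c : ℝ) (u : ℕ → ℝ) :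
    ∑ n ∈ Icc 1 M, (Nat.totient n : ℝ) * (c * u n) ^ 2 = c ^ 2 * ∑ n ∈ Icc 1 M, (Nat.totient n : ℝ) * u n ^ 2 := by
  rw [mul_sum]; exact sum_congr rfl fun n _ => by ring

/-- Scaling of `Σ μ u`. [folklore] -/
private theorem mobForm_smul (M : ℕ) (c : ℝ) (u : ℕ → ℝ) :
    mobForm M (fun n => c * u n) = c * mobForm M u := by
  unfold mobForm
  rw [mul_sum]; exact sum_congr rfl fun n _ => by ring

/-- Polarisation of `F_{M,0}`: `F_{M,0}(u+v) = F_{M,0}(u) + 2·bil0(u,v) + F_{M,0}(v)`.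
[cite: Radziwill2012, §7 (decomposition `S₁ − S₂ + S₃`) — derivation] -/
theorem scForm_zero_add (M : ℕ) (u v : ℕ → ℝ) :
    scForm M 0 (fun n => u n + v n) = scForm M 0 u + 2 * bil0 M u v + scForm M 0 v := by
  unfold scForm bil0
  have h1 : ∑ n ∈ Icc 1 M, (Nat.totient n : ℝ) * (0 + kappa n) * (u n + v n) ^ 2
      = ∑ n ∈ Icc 1 M, (Nat.totient n : ℝ) * (0 + kappa n) * u n ^ 2
        + 2 * ∑ n ∈ Icc 1 M, (Nat.totient n : ℝ) * kappa n * u n * v n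
        + ∑ n ∈ Icc 1 M, (Nat.totient n : ℝ) * (0 + kappa n) * v n ^ 2 := by
    rw [mul_sum, ← sum_add_distrib, ← sum_add_distrib]
    exact sum_congr rfl fun n _ => by ring
  have h2 : ∑ n ∈ Icc 1 M, ∑ m ∈ Icc 1 M, wt n m * (u n + v n) * (u m + v m)
      = ∑ n ∈ Icc 1 M, ∑ m ∈ Icc 1 M, wt n m * u n * u m
        + ∑ n ∈ Icc 1 M, ∑ m ∈ Icc 1 M, wt n m * (u n * v m + u m * v n)
        + ∑ n ∈ Icc 1 M, ∑ m ∈ Icc 1 M, wt n m * v n * v m := by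
    rw [← sum_add_distrib, ← sum_add_distrib]
    refine sum_congr rfl fun n _ => ?_
    rw [← sum_add_distrib, ← sum_add_distrib]
    exact sum_congr rfl fun m _ => by ring
  rw [h1, h2]; ring

/-- `bil0(u,v) = Σ_m v_m · c_m(u)` (one exchange of summation). [cite: Radziwill2012, §7 Lemma 13 — derivation] -/
theorem bil0_eq_sum_linCoeff (M : ℕ) (u v : ℕ → ℝ) :
    bil0 M u v = ∑ m ∈ Icc 1 M, v m * linCoeff M u m := by
  unfold bil0 linCoeff
  have hA : ∑ n ∈ Icc 1 M, ∑ m ∈ Icc 1 M, wt n m * (u n * v m + u m * v n)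
      = ∑ m ∈ Icc 1 M, v m * ∑ n ∈ Icc 1 M, wt n m * u n
        + ∑ n ∈ Icc 1 M, v n * ∑ k ∈ Icc 1 M, wt n k * u k := by
    have : ∑ n ∈ Icc 1 M, ∑ m ∈ Icc 1 M, wt n m * (u n * v m + u m * v n)
        = ∑ n ∈ Icc 1 M, ∑ m ∈ Icc 1 M, wt n m * (u n * v m)
          + ∑ n ∈ Icc 1 M, ∑ m ∈ Icc 1 M, wt n m * (u m * v n) := by
      rw [← sum_add_distrib]
      refine sum_congr rfl fun n _ => ?_
      rw [← sum_add_distrib]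
      exact sum_congr rfl fun m _ => by ring
    rw [this]
    congr 1
    · rw [sum_comm]
      refine sum_congr rfl fun m _ => ?_
      rw [mul_sum]
      exact sum_congr rfl fun n _ => by ring
    · refine sum_congr rfl fun n _ => ?_
      rw [mul_sum]
      exact sum_congr rfl fun k _ => by ring
  rw [hA]
  have : ∑ m ∈ Icc 1 M, v m * ((Nat.totient m : ℝ) * kappa m * u m - ∑ n ∈ Icc 1 M, wt n m * u n
        - ∑ k ∈ Icc 1 M, wt m k * u k)
      = ∑ m ∈ Icc 1 M, (Nat.totient m : ℝ) * kappa m * u m * v m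
        - ∑ m ∈ Icc 1 M, v m * ∑ n ∈ Icc 1 M, wt n m * u n
        - ∑ n ∈ Icc 1 M, v n * ∑ k ∈ Icc 1 M, wt n k * u k := by
    rw [← sum_sub_distrib, ← sum_sub_distrib]
    exact sum_congr rfl fun m _ => by ring
  rw [this]; ring

/-- The centred decomposition of the full form:
`F_{M,L}(z+e) = F_{M,L}(z) + 2(L·Σφ z e + bil0(z,e)) + (L·Σφ e² + F_{M,0}(e))`.
[cite: Radziwill2012, §7 (Lemmas 9–10 combined) — derivation] -/
theorem scForm_add (M : ℕ) (L : ℝ) (z e : ℕ → ℝ) :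
    scForm M L (fun n => z n + e n)
      = scForm M L z
        + 2 * (L * ∑ n ∈ Icc 1 M, (Nat.totient n : ℝ) * z n * e n + bil0 M z e)
        + (L * ∑ n ∈ Icc 1 M, (Nat.totient n : ℝ) * e n ^ 2 + scForm M 0 e) := by
  rw [scForm_split M L (fun n => z n + e n), scForm_split M L z, scForm_zero_add]
  have : ∑ n ∈ Icc 1 M, (Nat.totient n : ℝ) * (z n + e n) ^ 2
      = ∑ n ∈ Icc 1 M, (Nat.totient n : ℝ) * z n ^ 2
        + 2 * ∑ n ∈ Icc 1 M, (Nat.totient n : ℝ) * z n * e n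
        + ∑ n ∈ Icc 1 M, (Nat.totient n : ℝ) * e n ^ 2 := by
    rw [mul_sum, ← sum_add_distrib, ← sum_add_distrib]
    exact sum_congr rfl fun n _ => by ring
  rw [this]; ring

/-- **AM–GM on the divisor-chain coupling**: `2Σ_{n,m} w(n,m) e_n e_m ≤ Σ_n φ(n)·cAM(n)·e_n²`
(termwise `2ab ≤ (n/m)a² + (m/n)b²`, then one exchange of summation).
[cite: Radziwill2012, §7 Lemma 12 — derivation] -/
theorem two_mul_cross_le (M : ℕ) (e : ℕ → ℝ) :
    2 * ∑ n ∈ Icc 1 M, ∑ m ∈ Icc 1 M, wt n m * e n * e m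
      ≤ ∑ n ∈ Icc 1 M, (Nat.totient n : ℝ) * cAM M n * e n ^ 2 := by
  -- termwise inequality
  have key : ∀ n ∈ Icc 1 M, ∀ m ∈ Icc 1 M,
      2 * (wt n m * e n * e m) ≤ wt n m * ((n : ℝ) / (m : ℝ)) * e n ^ 2 + wt n m * ((m : ℝ) / (n : ℝ)) * e m ^ 2 := by
    intro n hn m hm
    have hn1 : (0 : ℝ) < n := by exact_mod_cast (mem_Icc.mp hn).1
    have hm1 : (0 : ℝ) < m := by exact_mod_cast (mem_Icc.mp hm).1
    have hw := wt_nonneg n m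
    have hsq : 2 * (e n * e m) ≤ (n : ℝ) / (m : ℝ) * e n ^ 2 + (m : ℝ) / (n : ℝ) * e m ^ 2 := by
      have h0 : 0 ≤ ((n : ℝ) * e n - (m : ℝ) * e m) ^ 2 / ((n : ℝ) * (m : ℝ)) :=
        div_nonneg (sq_nonneg _) (mul_pos hn1 hm1).le
      have hexp : ((n : ℝ) * e n - (m : ℝ) * e m) ^ 2 / ((n : ℝ) * (m : ℝ))
          = (n : ℝ) / (m : ℝ) * e n ^ 2 + (m : ℝ) / (n : ℝ) * e m ^ 2 - 2 * (e n * e m) := by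
        field_simp
        ring
      linarith [hexp ▸ h0]
    nlinarith [mul_le_mul_of_nonneg_left hsq hw]
  -- sum the termwise inequality
  have hsum : 2 * ∑ n ∈ Icc 1 M, ∑ m ∈ Icc 1 M, wt n m * e n * e m
      ≤ ∑ n ∈ Icc 1 M, ∑ m ∈ Icc 1 M,
          (wt n m * ((n : ℝ) / (m : ℝ)) * e n ^ 2 + wt n m * ((m : ℝ) / (n : ℝ)) * e m ^ 2) := by
    rw [mul_sum]
    refine sum_le_sum fun n hn => ?_
    rw [mul_sum]
    exact sum_le_sum fun m hm => key n hn m hm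
  -- regroup the right-hand side
  have hre : ∑ n ∈ Icc 1 M, ∑ m ∈ Icc 1 M,
        (wt n m * ((n : ℝ) / (m : ℝ)) * e n ^ 2 + wt n m * ((m : ℝ) / (n : ℝ)) * e m ^ 2)
      = ∑ n ∈ Icc 1 M, (Nat.totient n : ℝ) * cAM M n * e n ^ 2 := by
    have hsplit : (∑ n ∈ Icc 1 M, ∑ m ∈ Icc 1 M,
          (wt n m * ((n : ℝ) / (m : ℝ)) * e n ^ 2 + wt n m * ((m : ℝ) / (n : ℝ)) * e m ^ 2))
        = (∑ n ∈ Icc 1 M, ∑ m ∈ Icc 1 M, wt n m * ((n : ℝ) / (m : ℝ)) * e n ^ 2)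
          + ∑ n ∈ Icc 1 M, ∑ m ∈ Icc 1 M, wt n m * ((m : ℝ) / (n : ℝ)) * e m ^ 2 := by
      simp only [sum_add_distrib]
    rw [hsplit]
    rw [sum_comm (f := fun n m => wt n m * ((m : ℝ) / (n : ℝ)) * e m ^ 2), ← sum_add_distrib]
    refine sum_congr rfl fun n hn => ?_
    have hφ := (totient_pos_of_mem hn).ne'
    unfold cAM
    rw [mul_div_cancel₀ _ hφ, add_mul, sum_mul, sum_mul]
  exact hsum.trans hre.le

/-! ### The theorem -/

/-- **Soundararajan's completion of squares for the `GL(2)` harmonic main-term form (explicit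
finite version).** Let `M ≥ 1`, `L, Λ♯, t ∈ ℝ` with `cAM(n) − κ(n) ≤ Λ♯` for all `n ≤ M` and
`Λ♯ < L`. Then for every real `A` with `Σ_{n≤M} μ(n)A_n = 1`,
`F_{M,L}(A) ≥ L/G + P/G² − B(t)/(G²(L − Λ♯))`.
Proof: write `A = z + e`, `z = (μ/φ)/G`; then `Σμe = 0`, `Σφ A² = 1/G + Σφe²` (Lemma 9),
`F_{M,L}(z) = L/G + P/G²`, the linear term is `(2/G)Σ_m e_m(c_m − tμ(m))`, bounded by Cauchy–Schwarz by
`(2/G)√(B(t)·D)`, `D = Σφe²`, and `F_{M,0}(e) ≥ −(Λ♯)·D` after the `κ`-diagonal cancels the `κ`-part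
of the AM–GM bound; finally `aD + (2/G)s ≥ −B/(G²a)` for `s² ≤ BD`, `a = L − Λ♯ > 0`.
Consequence (homogeneity): `(Σμ(n)A_n)² ≤ F_{M,L}(A)/m_*` for all `A` when `m_* := RHS > 0`, i.e.
in the KMV model `sup_x ℓ(x)²/(2xᵀKx) ≤ 1/(2m_*)`; on paper `m_* → 1 + 1/Δ` for `L = (log M)/Δ`,
`Δ < 1` (the cell's certified table, kit j260771). The `GL(2)` analogue of
[cite: Radziwill2012, §7 Proposition B (Soundararajan) with Lemmas 9, 10, 12, 13, 14 — derivation] -/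
theorem scForm_ge_of_mobForm_eq_one {M : ℕ} (hM : 1 ≤ M) (L Λs t : ℝ)
    (hΛ : ∀ n ∈ Icc 1 M, cAM M n - kappa n ≤ Λs) (hL : Λs < L)
    (A : ℕ → ℝ) (hA : mobForm M A = 1) :
    L / scG M + scP M / scG M ^ 2 - scB M t / (scG M ^ 2 * (L - Λs)) ≤ scForm M L A := by
  set G := scG M with hGdef
  have hG : 0 < G := scG_pos hM
  have hGne : G ≠ 0 := hG.ne'
  -- centre and deviation
  set z : ℕ → ℝ := fun n => G⁻¹ * zc n with hzdef
  set e : ℕ → ℝ := fun n => A n - z n with hedef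
  have hAze : A = fun n => z n + e n := by funext n; simp [hedef]
  -- (i) Σ μ e = 0
  have hmu_e : ∑ n ∈ Icc 1 M, (ArithmeticFunction.moebius n : ℝ) * e n = 0 := by
    have h1 : ∑ n ∈ Icc 1 M, (ArithmeticFunction.moebius n : ℝ) * e n
        = mobForm M A - G⁻¹ * mobForm M zc := by
      rw [← mobForm_smul]
      unfold mobForm
      rw [← sum_sub_distrib]
      exact sum_congr rfl fun n _ => by simp [hedef, hzdef]; ring
    rw [h1, hA, mobForm_zc, ← hGdef, inv_mul_cancel₀ hGne]; ring
  -- (ii) L-part cross term vanishes: Σ φ z e = (1/G) Σ μ e = 0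
  have hcross : ∑ n ∈ Icc 1 M, (Nat.totient n : ℝ) * z n * e n = 0 := by
    have : ∑ n ∈ Icc 1 M, (Nat.totient n : ℝ) * z n * e n
        = G⁻¹ * (∑ n ∈ Icc 1 M, (ArithmeticFunction.moebius n : ℝ) * e n) := by
      rw [mul_sum]
      refine sum_congr rfl fun n hn => ?_
      have hφ := (totient_pos_of_mem hn).ne'
      simp only [hzdef, zc]
      field_simp
    rw [this, hmu_e, mul_zero]
  -- (iii) the constant part F(z) = L/G + P/G²
  have hFz : scForm M L z = L / G + scP M / G ^ 2 := by
    have hsq : ∑ n ∈ Icc 1 M, (Nat.totient n : ℝ) * z n ^ 2 = 1 / G := by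
      rw [hzdef, sum_totient_sq_smul, sum_totient_zc_sq, ← hGdef]
      field_simp
    have h0 : scForm M 0 z = scP M / G ^ 2 := by
      rw [hzdef, scForm_smul]
      unfold scP
      field_simp
    rw [scForm_split, hsq, h0]; ring
  -- (iv) the linear part equals (1/G) Σ e_m (c_m(zc) − t μ_m)
  have hlin : bil0 M z e = (∑ m ∈ Icc 1 M, e m * (linCoeff M zc m - t * (ArithmeticFunction.moebius m : ℝ))) / G := by
    rw [bil0_eq_sum_linCoeff]
    have hc : ∀ m, linCoeff M z m = linCoeff M zc m / G := by
      intro m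
      rw [hzdef, linCoeff_smul]
      field_simp
    have : ∑ m ∈ Icc 1 M, e m * (linCoeff M zc m - t * (ArithmeticFunction.moebius m : ℝ))
        = ∑ m ∈ Icc 1 M, e m * linCoeff M zc m - t * ∑ m ∈ Icc 1 M, (ArithmeticFunction.moebius m : ℝ) * e m := by
      rw [mul_sum, ← sum_sub_distrib]
      exact sum_congr rfl fun m _ => by ring
    rw [this, hmu_e, mul_zero, sub_zero, Finset.sum_div]
    exact sum_congr rfl fun m _ => by rw [hc]; ring
  -- (v) Cauchy–Schwarz: s² ≤ B(t)·D
  set s := ∑ m ∈ Icc 1 M, e m * (linCoeff M zc m - t * (ArithmeticFunction.moebius m : ℝ)) with hsdef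
  set D := ∑ n ∈ Icc 1 M, (Nat.totient n : ℝ) * e n ^ 2 with hDdef
  have hD : 0 ≤ D := sum_nonneg fun n hn => mul_nonneg (totient_pos_of_mem hn).le (sq_nonneg _)
  have hB : 0 ≤ scB M t := sum_nonneg fun m hm => div_nonneg (sq_nonneg _) (totient_pos_of_mem hm).le
  have hCS : s ^ 2 ≤ scB M t * D := by
    have h := Finset.sum_mul_sq_le_sq_mul_sq (Icc 1 M)
      (fun m => (linCoeff M zc m - t * (ArithmeticFunction.moebius m : ℝ)) / Real.sqrt (Nat.totient m : ℝ))
      (fun m => Real.sqrt (Nat.totient m : ℝ) * e m)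
    have hfg : ∀ m ∈ Icc 1 M,
        (linCoeff M zc m - t * (ArithmeticFunction.moebius m : ℝ)) / Real.sqrt (Nat.totient m : ℝ)
          * (Real.sqrt (Nat.totient m : ℝ) * e m)
        = e m * (linCoeff M zc m - t * (ArithmeticFunction.moebius m : ℝ)) := by
      intro m hm
      have hφ := totient_pos_of_mem hm
      have hs : Real.sqrt (Nat.totient m : ℝ) ≠ 0 := (Real.sqrt_pos.mpr hφ).ne'
      field_simp
    have hf2 : ∀ m ∈ Icc 1 M,
        ((linCoeff M zc m - t * (ArithmeticFunction.moebius m : ℝ)) / Real.sqrt (Nat.totient m : ℝ)) ^ 2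
        = (linCoeff M zc m - t * (ArithmeticFunction.moebius m : ℝ)) ^ 2 / (Nat.totient m : ℝ) := by
      intro m hm
      have hφ := totient_pos_of_mem hm
      rw [div_pow, Real.sq_sqrt hφ.le]
    have hg2 : ∀ m ∈ Icc 1 M, (Real.sqrt (Nat.totient m : ℝ) * e m) ^ 2 = (Nat.totient m : ℝ) * e m ^ 2 := by
      intro m hm
      have hφ := totient_pos_of_mem hm
      rw [mul_pow, Real.sq_sqrt hφ.le]
    rw [sum_congr rfl hfg, sum_congr rfl hf2, sum_congr rfl hg2] at h
    simpa [hsdef, hDdef, scB] using h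
  -- (vi) the quadratic part: L·D + F_{M,0}(e) ≥ (L − Λs)·D
  have hquad : (L - Λs) * D ≤ L * D + scForm M 0 e := by
    have hcr := two_mul_cross_le M e
    have hdiag : scForm M 0 e = ∑ n ∈ Icc 1 M, (Nat.totient n : ℝ) * kappa n * e n ^ 2
        - 2 * ∑ n ∈ Icc 1 M, ∑ m ∈ Icc 1 M, wt n m * e n * e m := by
      unfold scForm; simp only [zero_add]
    have hbound : ∑ n ∈ Icc 1 M, (Nat.totient n : ℝ) * cAM M n * e n ^ 2
        - ∑ n ∈ Icc 1 M, (Nat.totient n : ℝ) * kappa n * e n ^ 2 ≤ Λs * D := by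
      rw [hDdef, mul_sum, ← sum_sub_distrib]
      refine sum_le_sum fun n hn => ?_
      have hφe : 0 ≤ (Nat.totient n : ℝ) * e n ^ 2 := mul_nonneg (totient_pos_of_mem hn).le (sq_nonneg _)
      have := mul_le_mul_of_nonneg_left (hΛ n hn) hφe
      nlinarith [this]
    rw [hdiag]
    nlinarith [hcr, hbound]
  -- (vii) assemble
  have hdecomp : scForm M L A = scForm M L z + 2 * (L * 0 + s / G) + (L * D + scForm M 0 e) := by
    rw [hAze, scForm_add, hcross, hlin]
  have ha : 0 < L - Λs := sub_pos.mpr hL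
  -- final elementary inequality: (2/G) s + (L-Λs) D ≥ −B/(G²(L−Λs))
  have hfin : -(scB M t / (G ^ 2 * (L - Λs))) ≤ 2 * (s / G) + (L - Λs) * D := by
    rcases hB.eq_or_lt with hB0 | hBpos
    · -- B = 0 ⇒ s = 0
      have hs0 : s = 0 := by
        have : s ^ 2 ≤ 0 := by rw [← hB0, zero_mul] at hCS; exact hCS
        exact pow_eq_zero_iff (n := 2) (by norm_num) |>.mp (le_antisymm this (sq_nonneg _))
      rw [← hB0, hs0]; simp; positivity
    · have hDge : s ^ 2 / scB M t ≤ D := by rw [div_le_iff₀ hBpos]; linarith [hCS]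
      have h1 : (L - Λs) * (s ^ 2 / scB M t) ≤ (L - Λs) * D := mul_le_mul_of_nonneg_left hDge ha.le
      have h2 : 0 ≤ ((L - Λs) / scB M t) * (s + scB M t / (G * (L - Λs))) ^ 2 :=
        mul_nonneg (div_nonneg ha.le hBpos.le) (sq_nonneg _)
      have h3 : ((L - Λs) / scB M t) * (s + scB M t / (G * (L - Λs))) ^ 2
          = (L - Λs) * (s ^ 2 / scB M t) + 2 * (s / G) + scB M t / (G ^ 2 * (L - Λs)) := by
        field_simp
        ring
      linarith [h1, h2, h3]
  rw [hdecomp, hFz]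
  linarith [hfin, hquad]

/-- **Rayleigh-quotient form** (homogeneity): under the same hypotheses, for EVERY real `A`,
`(Σ μ(n)A_n)² · m_* ≤ F_{M,L}(A)` with the explicit `m_* = L/G + P/G² − B(t)/(G²(L−Λ♯))` — in the
KMV model: `ℓ(x)² · m_* ≤ xᵀKx`, i.e. `sup_x ℓ(x)²/(2xᵀKx) ≤ 1/(2m_*)` when `m_* > 0`. [cite: Radziwill2012, §7 Proposition B — derivation (GL(2) analogue)] -/
theorem mobForm_sq_mul_le_scForm {M : ℕ} (hM : 1 ≤ M) (L Λs t : ℝ)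
    (hΛ : ∀ n ∈ Icc 1 M, cAM M n - kappa n ≤ Λs) (hL : Λs < L) (A : ℕ → ℝ) :
    mobForm M A ^ 2 * (L / scG M + scP M / scG M ^ 2 - scB M t / (scG M ^ 2 * (L - Λs)))
      ≤ scForm M L A := by
  set m := L / scG M + scP M / scG M ^ 2 - scB M t / (scG M ^ 2 * (L - Λs)) with hmdef
  by_cases h0 : mobForm M A = 0
  · -- then the claim is 0 ≤ F(A); apply the main theorem to A/c + z? Simpler: F(A) ≥ (L-Λs)·Σφ A² - ... ;
    -- we use the main theorem on A' = A + z (which has mobForm = 1) and on z, via the parallelogram-free route: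
    -- F(A) = F((A+z) - z); instead use scaling: for every c ≠ 0, F(A + c z)... ; cleanest: quadratic part bound.
    rw [h0]; simp only [ne_eq, OfNat.ofNat_ne_zero, not_false_eq_true, zero_pow, zero_mul]
    -- F(A) ≥ (L - Λs) Σφ A² + (2/1)·(linear) ... we instead apply the theorem to A + z and A - z? Use: A = z' + e with
    -- mobForm e = 0 is exactly the situation of the main proof with "1" replaced by "0"; we re-run the quadratic bound.
    have hD : 0 ≤ ∑ n ∈ Icc 1 M, (Nat.totient n : ℝ) * A n ^ 2 :=
      sum_nonneg fun n hn => mul_nonneg (totient_pos_of_mem hn).le (sq_nonneg _)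
    have hcr := two_mul_cross_le M A
    have hbound : ∑ n ∈ Icc 1 M, (Nat.totient n : ℝ) * cAM M n * A n ^ 2
        - ∑ n ∈ Icc 1 M, (Nat.totient n : ℝ) * kappa n * A n ^ 2
        ≤ Λs * ∑ n ∈ Icc 1 M, (Nat.totient n : ℝ) * A n ^ 2 := by
      rw [mul_sum, ← sum_sub_distrib]
      refine sum_le_sum fun n hn => ?_
      have hφe : 0 ≤ (Nat.totient n : ℝ) * A n ^ 2 := mul_nonneg (totient_pos_of_mem hn).le (sq_nonneg _)
      have := mul_le_mul_of_nonneg_left (hΛ n hn) hφe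
      nlinarith [this]
    rw [scForm_split]
    have hdiag : scForm M 0 A = ∑ n ∈ Icc 1 M, (Nat.totient n : ℝ) * kappa n * A n ^ 2
        - 2 * ∑ n ∈ Icc 1 M, ∑ m ∈ Icc 1 M, wt n m * A n * A m := by
      unfold scForm; simp only [zero_add]
    rw [hdiag]
    have ha : 0 < L - Λs := sub_pos.mpr hL
    nlinarith [hcr, hbound, hD, ha]
  · -- scale A to the constraint surface
    set c := mobForm M A with hcdef
    have hA' : mobForm M (fun n => c⁻¹ * A n) = 1 := by
      rw [mobForm_smul, ← hcdef, inv_mul_cancel₀ h0]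
    have hmain := scForm_ge_of_mobForm_eq_one hM L Λs t hΛ hL (fun n => c⁻¹ * A n) hA'
    rw [scForm_smul, ← hmdef] at hmain
    have hc2 : 0 < c ^ 2 := by positivity
    have hci : c⁻¹ ^ 2 = (c ^ 2)⁻¹ := by rw [inv_pow]
    rw [hci] at hmain
    have := (le_inv_mul_iff₀ hc2).mp hmain
    linarith [this]

end Literature.NumberTheory.LFunctions.KMV2000.SelbergCoord
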